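import Mathlib.RingTheory.MvPolynomial.WeightedHomogeneous
import Mathlib.RingTheory.FiniteType
import Mathlib.RingTheory.RegularLocalRing.Polynomial
import Mathlib.Algebra.Order.Antidiag.Finsupp
import Mathlib.Algebra.BigOperators.Fin
import Literature.AlgebraicGeometry.Resolution.AffineBlowupAlgebra
import Literature.AlgebraicGeometry.Resolution.AffineBlowup
import HarnessLib

/-!
# Splitting an exponent vector of degree `r * s` into `s` pieces of degree `r`

Support file for crux stmt-ResolutionOfSingularities-15317 (`FrobeniusLadder.FRationalResolution`), line `redirect`,
lead c5, CONE PROGRAMME (rung 4′ in all dimensions on the Veronese cones `V(n,r) = Spec k[χᵈ : |d| = r]`).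
We prove the combinatorial splitting fact behind "a monomial whose degree is a multiple `r * s` of `r`
is a product of `s` monomials of degree `r`": an exponent vector `d : Fin n →₀ ℕ` with
`Finsupp.degree d = r * s` is a sum `d = ∑ j : Fin s, e j` of `s` exponent vectors of degree `r`. [folklore]
-/

-- single-problem summit: the doubled namespace component is forced
set_option linter.dupNamespace false

noncomputable section

namespace Summit.ResolutionOfSingularities.ResolutionOfSingularities.Theorems.FRationalResolution

open MvPolynomial
open Literature.AlgebraicGeometry.Resolution

section Cones

variable (k : Type) [Field k]

/-- The polynomial ring in `n` variables. -/
local notation3 "MP[" n "]" => MvPolynomial (Fin n) k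

/-- The `r`-th Veronese subring of `k[x₁,…,xₙ]`: the `k`-subalgebra generated by the degree-`r` monomials. -/
local notation3 "VR[" n ", " r "]" =>
  Algebra.adjoin k ((fun d : Fin n →₀ ℕ => MvPolynomial.monomial d (1 : k)) ''
    {d : Fin n →₀ ℕ | Finsupp.degree d = (r : ℕ)})

/-- The vertex ideal of the Veronese cone: spanned by the degree-`r` monomials. -/
local notation3 "VM[" n ", " r "]" =>
  Ideal.span {v : ↥VR[n, r] | ∃ d : Fin n →₀ ℕ, Finsupp.degree d = (r : ℕ) ∧
    (v : MvPolynomial (Fin n) k) = MvPolynomial.monomial d 1}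

/-- **Degree splitting of exponent vectors.** If `d : Fin n →₀ ℕ` has total degree `r * s`, then
`d` is the sum of `s` exponent vectors `e j`, each of total degree `r`.

Proof: induction on `s`, generalizing `d`. For `s = 0` the degree of `d` vanishes, so `d = 0`
(`Finsupp.degree_eq_zero_iff`) and the empty family works. For `s + 1`, since
`r ≤ r * (s + 1) = degree d`, Mathlib's `Finsupp.exists_le_degree_eq` gives `e₀ ≤ d` of degree `r`;
writing `d = e₀ + d'` we get `degree d' = r * s`, split `d'` by induction and prepend `e₀`
with `Fin.cons` (`Fin.sum_univ_succ`). [folklore] -/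
theorem stub_finsupp_degree_split {n : ℕ} (r s : ℕ) (d : Fin n →₀ ℕ) (hd : Finsupp.degree d = r * s) :
    ∃ e : Fin s → (Fin n →₀ ℕ), (∀ j, Finsupp.degree (e j) = r) ∧ d = ∑ j, e j := by
  induction s generalizing d with
  | zero =>
    rw [Nat.mul_zero, Finsupp.degree_eq_zero_iff] at hd
    exact ⟨Fin.elim0, fun j => j.elim0, by simp [hd]⟩
  | succ s ih =>
    obtain ⟨e₀, he₀, hdeg⟩ := Finsupp.exists_le_degree_eq d r
      (by rw [hd, Nat.mul_succ]; exact Nat.le_add_left _ _)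
    obtain ⟨d', rfl⟩ := le_iff_exists_add.mp he₀
    have hd' : Finsupp.degree d' = r * s := by
      rw [map_add, hdeg, Nat.mul_succ] at hd
      omega
    obtain ⟨e', he', rfl⟩ := ih d' hd'
    refine ⟨Fin.cons e₀ e', Fin.forall_fin_succ.mpr ⟨?_, fun j => ?_⟩, ?_⟩
    · simpa only [Fin.cons_zero] using hdeg
    · simpa only [Fin.cons_succ] using he' j
    · simp only [Fin.sum_univ_succ, Fin.cons_zero, Fin.cons_succ]

end Cones

end Summit.ResolutionOfSingularities.ResolutionOfSingularities.Theorems.FRationalResolution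

end
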